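import Summits.ResolutionOfSingularities.ResolutionOfSingularities.Theorems.FrobeniusLadderFInjectiveMacaulayficationBrieskornPhamRowOfF108
import HarnessLib

/-!
# THE r-TERM FLOOR-SUM FEDDER CERTIFICATE `(Σ_l X_{i_l}^{b_l}·w_l)^N ∈ (X₀^p,…,X_{n−1}^p)` WHENEVER `Σ_l ⌊(p−1)/b_l⌋ < N`, the generic «NOT FULL from a multi-term chart»
# wrapper, rows along variable renamings, and the BRIESKORN–PHAM FAMILY WITHOUT ORDERING: NOT FULL / the conditional class row under the FIVE-FLOOR inequality
# `⌊(p−1)/c⌋ + ⌊(p−1)/(a₀−c)⌋ + ⌊(p−1)/a₁⌋ + ⌊(p−1)/a₂⌋ + ⌊(p−1)/a₃⌋ < p−1` — which reaches BED W `z³+x⁴+y⁵+u⁵+t⁷` (`p = 3`) through its `t`-chart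
# (crux `FInjectiveMacaulayfication` stmt-ResolutionOfSingularities-15315, chain w45a; res-L1-w45a-plan-1 RULING R22.12 (ii) + this seat's CHECKPOINT 00:39Z offer (γ); seat
# res-L1-w45a-stub-1 g14; sequel of ✓ `…BrieskornPhamSpecimen` / ✓ `…BrieskornPhamRowOfF108`; generalises ✓ `…TwoTermFedder` (`r = 2`))

[OURS · L1 W4.5a] Support file (`--supports stmt-ResolutionOfSingularities-15315 --as helper`); def-free; §1–§3 UNCONDITIONAL; §4–§5 CONDITIONAL on the named OURS hypothesis
`F108ClassRow.F108Consumable k 5` (an `@[conjecture]` interface predicate, NOT a Literature fact, NOT in the kernel) carried as an explicit binder `hF`. Nothing of the crux is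
proved; no unconditional census row is proved here (BED W's unconditional row of record is ✓ `P3d4z4557PointFloorRow.f4pos_row_p3_one`). AI-written (AI review is weaker than
expert review).

* §1 ★ `listSum_pow_mem_frobeniusPower` — for a list of triples `(i_l, b_l, w_l)` (variable, exponent `b_l ≥ 1`, arbitrary cofactor) and `N > Σ_l ⌊(p−1)/b_l⌋`:
  `(Σ_l X_{i_l}^{b_l}·w_l)^N ∈ (X₀^p,…,X_{n−1}^p)`. Proof by induction on the list with the binomial theorem: the term `m` of `(t₁ + S)^N` has `t₁^m ∈ (X_{i₁}^p)` when
  `b₁m ≥ p`, and otherwise `m ≤ ⌊(p−1)/b₁⌋`, so `S^{N−m}` falls under the induction hypothesis. (The designated variables need NOT be distinct; when they are, and the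
  cofactors are units/free variables, the bound is sharp — Fedder's criterion for `Σ X_{i_l}^{b_l}`.) `r = 2`, `N = p−1` is ✓ `TwoTermFedder.twoTerm_pow_mem_frobeniusPower`.
  `constantCoeff_listSum` (such a sum has no constant term).
* §2 ★ `pointFloor_not_full_of_multiTermChart` — ✓ `PointFloorNotFullOfFedder.pointFloor_not_full` with the Fedder binders DISCHARGED by a multi-term decomposition
  `g_{i₀} = Σ_l X_{i_l}^{b_l}·w_l` of ONE strict transform with `Σ_l ⌊(p−1)/b_l⌋ < p−1`: every blowing up along the point floor has a NON-FULL stalk over the closed point.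
* §3 `pointFloorRow_of_rename` — the two-sided census letter transports along a RENAMING of the variables (✓ `PolyAutRowTransport.pointFloorRow_of_algEquiv` with
  `φ = rename σ`): a bed may be written with its variables in any order.
* §4 THE BRIESKORN–PHAM FAMILY WITHOUT ORDERING (`2 ≤ c < a_j`, `a_j ≠ 0` in `k`, `c` free): `g_zero_eq_listSum` (the `x`-chart strict transform as a five-term list sum with
  designated exponents `c, a₀−c, a₁, a₂, a₃`), ★ `pointFloor_bp_not_full_of_fiveFloor (p)` (unconditional, primality witness `ω^{a₁} = −1`) and ★★
  `brieskornPhamRow_of_F108Consumable_of_fiveFloor` — LEGAL ∧ NOT FULL ∧ CURED under `⌊(p−1)/c⌋ + ⌊(p−1)/(a₀−c)⌋ + ⌊(p−1)/a₁⌋ + ⌊(p−1)/a₂⌋ + ⌊(p−1)/a₃⌋ < p−1`, NO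
  minimality of `a₀` (write the bed with the exponent to be certified FIRST; in the census regime `a_j ≥ p` the last three floors vanish and the condition reads
  `⌊(p−1)/c⌋ + ⌊(p−1)/(a₀−c)⌋ < p−1` for ANY of the four exponents — weakest for the LARGEST). HAND REMARK (not kernel): at the origin of the chart of `X_j` the exact
  non-F-purity criterion is «no `m ∈ ℕ⁵` with `Σm = p−1`, `c·m_z ≤ p−1`, `a_i m_i ≤ p−1 (i ≠ j)`, `Σ_i (a_i−c) m_i ≤ p−1`»; the five-floor inequality drops the last
  constraint's cross terms, the two-floor one of ✓ `…BrieskornPhamRowOfF108` uses minimality instead.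
* §5 ★ `bedW_row_of_F108Consumable` — BED W `z³ + x⁴ + y⁵ + u⁵ + t⁷`, `p = 3`, `k = k̄`: the conditional class row, by §4 for the exponent vector `(7,5,5,4)` (five floors
  `0+0+0+0+0 < 2`: the `t`-chart origin `z³ + t⁴ + t·x⁴ + t²y⁵ + t²u⁵` is not F-pure although the `x`-chart origin `z³ + x·unit` is regular) and §3 with the swap `x ↔ t`
  — the class route's CROSS-CERTIFICATE of the unconditional row ✓ `f4pos_row_p3_one` (cells), conditional on `F108Consumable k 5`.
[folklore mathematics, OURS as a certificate; cite: Fedder1983, Prop. 1.7 and Thm. 1.12; IshiiSingularities2018, Thm. 4.4.23; GortzWedhorn2020, Prop. 13.91 (2)]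
-/

-- single-problem summit: the doubled namespace component is forced
set_option linter.dupNamespace false

noncomputable section

namespace Summit.ResolutionOfSingularities.ResolutionOfSingularities.Theorems.FInjectiveMacaulayfication.BrieskornPhamMultiChart

open CategoryTheory CategoryTheory.Limits AlgebraicGeometry TopologicalSpace IsLocalRing MvPolynomial
open Literature.AlgebraicGeometry.Resolution
open Summit.ResolutionOfSingularities.ResolutionOfSingularities.Theorems.FInjectiveMacaulayfication
open SliceableCentre

variable (k : Type) [Field k] {n : ℕ}

/-! ## §1 The r-term floor-sum certificate -/

/-- ★ **THE r-TERM FLOOR-SUM FEDDER CERTIFICATE**: for triples `(i_l, b_l, w_l)` with `b_l ≥ 1` and `Σ_l ⌊(p−1)/b_l⌋ < N`, `(Σ_l X_{i_l}^{b_l}·w_l)^N ∈ (X₀^p,…,X_{n−1}^p)`.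
[folklore; cite: Fedder1983, Prop. 1.7] -/
theorem listSum_pow_mem_frobeniusPower (p : ℕ) (l : List (Fin n × ℕ × MvPolynomial (Fin n) k)) (hl : ∀ t ∈ l, 0 < t.2.1)
    (N : ℕ) (hN : (l.map fun t => (p - 1) / t.2.1).sum < N) :
    (l.map fun t => (X t.1 : MvPolynomial (Fin n) k) ^ t.2.1 * t.2.2).sum ^ N ∈ Ideal.span (Set.range fun j : Fin n => (X j : MvPolynomial (Fin n) k) ^ p) := by
  induction l generalizing N with
  | nil =>
    simp only [List.map_nil, List.sum_nil] at hN ⊢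
    rw [zero_pow (by omega)]
    exact Ideal.zero_mem _
  | cons t l ih =>
    simp only [List.map_cons, List.sum_cons, List.forall_mem_cons] at hN hl ⊢
    obtain ⟨ht, hl'⟩ := hl
    rw [add_pow]
    refine Ideal.sum_mem _ fun m hm => ?_
    rw [Finset.mem_range] at hm
    by_cases h1 : p ≤ t.2.1 * m
    · -- the `X_{i₁}`-degree of `t₁^m` is at least `p`
      have e1 : ((X t.1 : MvPolynomial (Fin n) k) ^ t.2.1 * t.2.2) ^ m = X t.1 ^ p * (X t.1 ^ (t.2.1 * m - p) * t.2.2 ^ m) := by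
        rw [mul_pow, ← pow_mul, ← mul_assoc, ← pow_add]
        congr 2
        omega
      rw [e1]
      exact Ideal.mul_mem_right _ _ (Ideal.mul_mem_right _ _ (Ideal.mul_mem_right _ _ (Ideal.subset_span ⟨t.1, rfl⟩)))
    · -- then `m ≤ ⌊(p−1)/b₁⌋`, so the rest carries an exponent above its floor sum
      have hm1 : m ≤ (p - 1) / t.2.1 := by
        rw [Nat.le_div_iff_mul_le ht]
        have h1' : t.2.1 * m < p := Nat.lt_of_not_le h1
        rw [Nat.mul_comm] at h1'
        omega
      have hN' : (l.map fun t => (p - 1) / t.2.1).sum < N - m := by omega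
      exact Ideal.mul_mem_right _ _ (Ideal.mul_mem_left _ _ (ih hl' (N - m) hN'))

/-- Such a sum has no constant term (`b_l ≥ 1`). [plumbing] -/
theorem constantCoeff_listSum (l : List (Fin n × ℕ × MvPolynomial (Fin n) k)) (hl : ∀ t ∈ l, 0 < t.2.1) :
    constantCoeff ((l.map fun t => (X t.1 : MvPolynomial (Fin n) k) ^ t.2.1 * t.2.2).sum) = 0 := by
  rw [map_list_sum, List.map_map]
  refine List.sum_eq_zero fun x hx => ?_
  obtain ⟨t, ht, rfl⟩ := List.mem_map.mp hx
  simp [constantCoeff_X, zero_pow (hl t ht).ne']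

/-! ## §2 ★ NOT FULL from a multi-term chart -/

/-- ★ **NOT FULL FROM A MULTI-TERM CHART** (`PointFloorNotFullOfFedder` currency with the Fedder binders discharged): `f` prime with point-blow-up chart identities
`θᵢ f = Xᵢ^{μᵢ}·gᵢ` (`f, gᵢ ∉ (Xᵢ)`, `f(0) = 0`), and ONE chart `i₀` whose strict transform decomposes as `g_{i₀} = Σ_l X_{i_l}^{b_l}·w_l` with `b_l ≥ 1` and
`Σ_l ⌊(p−1)/b_l⌋ < p−1`: for EVERY blowing up `g : S′ → Spec 𝒪_{X,v}` along the point floor some stalk of `S′` over the closed point is NOT `FullCl p`.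
[folklore assembly; cite: Fedder1983, Thm. 1.12] [cite: GortzWedhorn2020, Prop. 13.91 (2)] -/
theorem pointFloor_not_full_of_multiTermChart (p : ℕ) [Fact p.Prime] [CharP k p] (f : MvPolynomial (Fin n) k) (hf : Prime f) (μ : Fin n → ℕ)
    (g : Fin n → MvPolynomial (Fin n) k)
    (hθ : ∀ i : Fin n, aeval (fun j : Fin n => if j = i then (X i : MvPolynomial (Fin n) k) else X j * X i) f = X i ^ μ i * g i)
    (hfX : ∀ i : Fin n, f ∉ Ideal.span {(X i : MvPolynomial (Fin n) k)}) (hgX : ∀ i : Fin n, g i ∉ Ideal.span {(X i : MvPolynomial (Fin n) k)})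
    (hf0 : constantCoeff f = 0) (i₀ : Fin n) (l : List (Fin n × ℕ × MvPolynomial (Fin n) k)) (hl : ∀ t ∈ l, 0 < t.2.1)
    (hfl : (l.map fun t => (p - 1) / t.2.1).sum < p - 1) (hgi : g i₀ = (l.map fun t => (X t.1 : MvPolynomial (Fin n) k) ^ t.2.1 * t.2.2).sum)
    (v : Spec (.of (MvPolynomial (Fin n) k ⧸ Ideal.span {f}))) (hv : v.asIdeal = Ideal.span (Set.range (fun j : Fin n => Ideal.Quotient.mk (Ideal.span {f}) (X j))))
    (S' : Scheme.{0}) (g' : S' ⟶ Spec ((Spec (.of (MvPolynomial (Fin n) k ⧸ Ideal.span {f}))).presheaf.stalk v))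
    (hg' : IsBlowup g' ((affineBlowup.idealSheaf (Ideal.span (Set.range (fun j : Fin n => Ideal.Quotient.mk (Ideal.span {f}) (X j))))).comap
      ((Spec (.of (MvPolynomial (Fin n) k ⧸ Ideal.span {f}))).fromSpecStalk v))) :
    ∃ s : S', g'.base s = closedPoint ((Spec (.of (MvPolynomial (Fin n) k ⧸ Ideal.span {f}))).presheaf.stalk v) ∧ ¬ FullCl p (S'.presheaf.stalk s) := by
  have hc : constantCoeff (g i₀) = 0 := by rw [hgi]; exact constantCoeff_listSum k l hl
  have hfed : g i₀ ^ (p - 1) ∈ Ideal.span (Set.range fun j : Fin n => (X j : MvPolynomial (Fin n) k) ^ p) := by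
    rw [hgi]; exact listSum_pow_mem_frobeniusPower k p l hl (p - 1) hfl
  exact PointFloorNotFullOfFedder.pointFloor_not_full p k f hf μ g hθ hfX hgX hf0 i₀ hc hfed v hv S' g' hg'

/-! ## §3 Rows along a renaming of the variables -/

/-- **The two-sided row transports along a renaming of the variables**: if `rename σ f = f′` for a permutation `σ` of the variables and `V(f′)` has the row at its origin, so
does `V(f)` (✓ `PolyAutRowTransport.pointFloorRow_of_algEquiv` with `φ = rename σ`, whose values on variables are variables). [folklore; cite: GortzWedhorn2020, (13.19)] -/
theorem pointFloorRow_of_rename (p : ℕ) (σ : Equiv.Perm (Fin n)) (f f' : MvPolynomial (Fin n) k) (hff' : rename σ f = f')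
    (hrow : ∀ (v : Spec (.of (MvPolynomial (Fin n) k ⧸ Ideal.span {f'}))),
      v.asIdeal = Ideal.span (Set.range fun j : Fin n => Ideal.Quotient.mk (Ideal.span {f'}) (X j)) →
      ∀ (S' : Scheme.{0}) (g₁ : S' ⟶ Spec ((Spec (.of (MvPolynomial (Fin n) k ⧸ Ideal.span {f'}))).presheaf.stalk v)),
        IsBlowup g₁ ((affineBlowup.idealSheaf (Ideal.span (Set.range fun j : Fin n => Ideal.Quotient.mk (Ideal.span {f'}) (X j)))).comap
          ((Spec (.of (MvPolynomial (Fin n) k ⧸ Ideal.span {f'}))).fromSpecStalk v)) →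
        (((affineBlowup.idealSheaf (Ideal.span (Set.range fun j : Fin n => Ideal.Quotient.mk (Ideal.span {f'}) (X j)))).comap
            ((Spec (.of (MvPolynomial (Fin n) k ⧸ Ideal.span {f'}))).fromSpecStalk v)) ≠ ⊥ ∧
          ((((affineBlowup.idealSheaf (Ideal.span (Set.range fun j : Fin n => Ideal.Quotient.mk (Ideal.span {f'}) (X j)))).comap
            ((Spec (.of (MvPolynomial (Fin n) k ⧸ Ideal.span {f'}))).fromSpecStalk v)).support :
              Set (Spec ((Spec (.of (MvPolynomial (Fin n) k ⧸ Ideal.span {f'}))).presheaf.stalk v))) ⊆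
            (Scheme.regularLocus (Spec ((Spec (.of (MvPolynomial (Fin n) k ⧸ Ideal.span {f'}))).presheaf.stalk v)))ᶜ) ∧
          (∀ s : S', g₁.base s ≠ closedPoint _ → s ∈ Scheme.regularLocus S') ∧ (∀ s : S', CMCl (S'.presheaf.stalk s))) ∧
        (∃ s : S', g₁.base s = closedPoint _ ∧ ¬ FullCl p (S'.presheaf.stalk s)) ∧
        (∃ 𝓚 : S'.IdealSheafData, 𝓚 ≠ ⊥ ∧ (∀ s ∈ (𝓚.support : Set S'), g₁.base s = closedPoint _) ∧
          ∀ (S'' : Scheme.{0}) (π : S'' ⟶ S'), IsBlowup π 𝓚 → ∀ s : S'', FullCl p (S''.presheaf.stalk s))) :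
    ∀ (v' : Spec (.of (MvPolynomial (Fin n) k ⧸ Ideal.span {f}))),
      v'.asIdeal = Ideal.span (Set.range fun j : Fin n => Ideal.Quotient.mk (Ideal.span {f}) (X j)) →
      ∀ (S' : Scheme.{0}) (g₁ : S' ⟶ Spec ((Spec (.of (MvPolynomial (Fin n) k ⧸ Ideal.span {f}))).presheaf.stalk v')),
        IsBlowup g₁ ((affineBlowup.idealSheaf (Ideal.span (Set.range fun j : Fin n => Ideal.Quotient.mk (Ideal.span {f}) (X j)))).comap
          ((Spec (.of (MvPolynomial (Fin n) k ⧸ Ideal.span {f}))).fromSpecStalk v')) →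
        (((affineBlowup.idealSheaf (Ideal.span (Set.range fun j : Fin n => Ideal.Quotient.mk (Ideal.span {f}) (X j)))).comap
            ((Spec (.of (MvPolynomial (Fin n) k ⧸ Ideal.span {f}))).fromSpecStalk v')) ≠ ⊥ ∧
          ((((affineBlowup.idealSheaf (Ideal.span (Set.range fun j : Fin n => Ideal.Quotient.mk (Ideal.span {f}) (X j)))).comap
            ((Spec (.of (MvPolynomial (Fin n) k ⧸ Ideal.span {f}))).fromSpecStalk v')).support :
              Set (Spec ((Spec (.of (MvPolynomial (Fin n) k ⧸ Ideal.span {f}))).presheaf.stalk v'))) ⊆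
            (Scheme.regularLocus (Spec ((Spec (.of (MvPolynomial (Fin n) k ⧸ Ideal.span {f}))).presheaf.stalk v')))ᶜ) ∧
          (∀ s : S', g₁.base s ≠ closedPoint _ → s ∈ Scheme.regularLocus S') ∧ (∀ s : S', CMCl (S'.presheaf.stalk s))) ∧
        (∃ s : S', g₁.base s = closedPoint _ ∧ ¬ FullCl p (S'.presheaf.stalk s)) ∧
        (∃ 𝓚 : S'.IdealSheafData, 𝓚 ≠ ⊥ ∧ (∀ s ∈ (𝓚.support : Set S'), g₁.base s = closedPoint _) ∧
          ∀ (S'' : Scheme.{0}) (π : S'' ⟶ S'), IsBlowup π 𝓚 → ∀ s : S'', FullCl p (S''.presheaf.stalk s)) :=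
  PolyAutRowTransport.pointFloorRow_of_algEquiv k p (renameEquiv k σ).toRingEquiv
    (fun i => by simp [rename_X, constantCoeff_X])
    (fun i => by simp [rename_X, constantCoeff_X]) f f' hff' hrow

/-! ## §4 The Brieskorn–Pham family without ordering: the five-floor certificate at the `x`-chart -/

/-- The `x`-chart strict transform as a FIVE-TERM LIST SUM with designated exponents `c, a₀−c, a₁, a₂, a₃`. [plumbing] -/
theorem g_zero_eq_listSum (c a₀ a₁ a₂ a₃ : ℕ) :
    (X 4 ^ c + X 0 ^ (a₀ - c) + X 0 ^ (a₁ - c) * X 1 ^ a₁ + X 0 ^ (a₂ - c) * X 2 ^ a₂ + X 0 ^ (a₃ - c) * X 3 ^ a₃ : MvPolynomial (Fin 5) k) =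
      (([((4 : Fin 5), c, (1 : MvPolynomial (Fin 5) k)), (0, a₀ - c, 1), (1, a₁, X 0 ^ (a₁ - c)), (2, a₂, X 0 ^ (a₂ - c)), (3, a₃, X 0 ^ (a₃ - c))] :
        List (Fin 5 × ℕ × MvPolynomial (Fin 5) k)).map fun t => (X t.1 : MvPolynomial (Fin 5) k) ^ t.2.1 * t.2.2).sum := by
  simp only [List.map_cons, List.map_nil, List.sum_cons, List.sum_nil]
  ring

/-- ★ **THE POINT FLOOR OF THE BRIESKORN–PHAM FAMILY IS NOT FULL UNDER THE FIVE-FLOOR INEQUALITY** `⌊(p−1)/c⌋ + ⌊(p−1)/(a₀−c)⌋ + ⌊(p−1)/a₁⌋ + ⌊(p−1)/a₂⌋ + ⌊(p−1)/a₃⌋ < p−1`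
(NO ordering of the exponents — the exponent to be certified is written first; `a₀ ≠ 0` in `k` and a primality witness `ω^{a₁} = −1`): the `x`-chart strict transform is the
five-term sum of §4 `g_zero_eq_listSum` (§2). [OURS · p-uniform negative certificate; cite: Fedder1983, Thm. 1.12] -/
theorem pointFloor_bp_not_full_of_fiveFloor (p : ℕ) [Fact p.Prime] [CharP k p] (c a₀ a₁ a₂ a₃ : ℕ) (hc : 2 ≤ c) (h₀ : c < a₀) (h₁ : c < a₁) (h₂ : c < a₂) (h₃ : c < a₃)
    (ha₀ : ((a₀ : ℕ) : k) ≠ 0) (ω : k) (hω : ω ^ a₁ + 1 = 0) (hΦ : (p - 1) / c + (p - 1) / (a₀ - c) + (p - 1) / a₁ + (p - 1) / a₂ + (p - 1) / a₃ < p - 1)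
    (f : MvPolynomial (Fin 5) k) (hf : f = X 4 ^ c + X 0 ^ a₀ + X 1 ^ a₁ + X 2 ^ a₂ + X 3 ^ a₃)
    (v : Spec (.of (MvPolynomial (Fin 5) k ⧸ Ideal.span {f})))
    (hv : v.asIdeal = Ideal.span (Set.range (fun j : Fin 5 => Ideal.Quotient.mk (Ideal.span {f}) (X j))))
    (S' : Scheme.{0}) (g : S' ⟶ Spec ((Spec (.of (MvPolynomial (Fin 5) k ⧸ Ideal.span {f}))).presheaf.stalk v))
    (hg : IsBlowup g ((affineBlowup.idealSheaf (Ideal.span (Set.range (fun j : Fin 5 => Ideal.Quotient.mk (Ideal.span {f}) (X j))))).comap ((Spec (.of (MvPolynomial (Fin 5) k ⧸ Ideal.span {f}))).fromSpecStalk v))) :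
    ∃ s : S', g.base s = closedPoint ((Spec (.of (MvPolynomial (Fin 5) k ⧸ Ideal.span {f}))).presheaf.stalk v) ∧ ¬ FullCl p (S'.presheaf.stalk s) :=
  pointFloor_not_full_of_multiTermChart k p f (BrieskornPhamSpecimen.prime_f k c a₀ a₁ a₂ a₃ hc h₂ h₃ ha₀ ω hω f hf) (fun _ : Fin 5 => c) _
    (BrieskornPhamRowOfF108.theta k c a₀ a₁ a₂ a₃ h₀ h₁ h₂ h₃ f hf) (BrieskornPhamSpecimen.f_not_mem_span_X k c a₀ a₁ a₂ a₃ hc h₀ h₁ h₂ h₃ f hf)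
    (BrieskornPhamRowOfF108.g_not_mem_span_X k c a₀ a₁ a₂ a₃ h₀ h₁ h₂ h₃) (BrieskornPhamSpecimen.constantCoeff_f k c a₀ a₁ a₂ a₃ hc h₀ h₁ h₂ h₃ f hf) 0
    [((4 : Fin 5), c, (1 : MvPolynomial (Fin 5) k)), (0, a₀ - c, 1), (1, a₁, X 0 ^ (a₁ - c)), (2, a₂, X 0 ^ (a₂ - c)), (3, a₃, X 0 ^ (a₃ - c))]
    (by simp only [List.mem_cons, List.not_mem_nil, or_false]; rintro t (rfl | rfl | rfl | rfl | rfl) <;> simp only <;> omega)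
    (by simp only [List.map_cons, List.map_nil, List.sum_cons, List.sum_nil]; omega)
    (by rw [Matrix.cons_val_zero]; exact g_zero_eq_listSum k c a₀ a₁ a₂ a₃) v hv S' g hg

/-- ★★ **THE BRIESKORN–PHAM CONDITIONAL CLASS ROW UNDER THE FIVE-FLOOR INEQUALITY** (no ordering of the exponents): CONDITIONAL on `F108ClassRow.F108Consumable k 5`, for
`k = k̄` of characteristic `p`, `2 ≤ c < a_j`, `a_j ≠ 0` in `k`, `⌊(p−1)/c⌋ + ⌊(p−1)/(a₀−c)⌋ + ⌊(p−1)/a₁⌋ + ⌊(p−1)/a₂⌋ + ⌊(p−1)/a₃⌋ < p−1`, and every blowing up of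
`Spec 𝒪_{X,v}` along the point floor of `X = V(z^c + x^{a₀} + y^{a₁} + u^{a₂} + t^{a₃})`: LEGAL ∧ NOT FULL ∧ CURED. ONE term on ✓ `F108ClassRow.pointFloorRow_of_F108Consumable`
with ✓ `BrieskornPhamSpecimen` and the five-term certificate (§1, §4). [OURS · conditional class row; cite: IshiiSingularities2018, Thm. 4.4.23; Fedder1983, Thm. 1.12] -/
theorem brieskornPhamRow_of_F108Consumable_of_fiveFloor (p : ℕ) [Fact p.Prime] [IsAlgClosed k] [CharP k p] (hF : F108ClassRow.F108Consumable k 5)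
    (c a₀ a₁ a₂ a₃ : ℕ) (hc : 2 ≤ c) (h₀ : c < a₀) (h₁ : c < a₁) (h₂ : c < a₂) (h₃ : c < a₃)
    (ha₀ : ((a₀ : ℕ) : k) ≠ 0) (ha₁ : ((a₁ : ℕ) : k) ≠ 0) (ha₂ : ((a₂ : ℕ) : k) ≠ 0) (ha₃ : ((a₃ : ℕ) : k) ≠ 0)
    (hΦ : (p - 1) / c + (p - 1) / (a₀ - c) + (p - 1) / a₁ + (p - 1) / a₂ + (p - 1) / a₃ < p - 1)
    (f : MvPolynomial (Fin 5) k) (hf : f = X 4 ^ c + X 0 ^ a₀ + X 1 ^ a₁ + X 2 ^ a₂ + X 3 ^ a₃)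
    (v : Spec (.of (MvPolynomial (Fin 5) k ⧸ Ideal.span {f})))
    (hv : v.asIdeal = Ideal.span (Set.range (fun j : Fin 5 => Ideal.Quotient.mk (Ideal.span {f}) (X j))))
    (S' : Scheme.{0}) (g : S' ⟶ Spec ((Spec (.of (MvPolynomial (Fin 5) k ⧸ Ideal.span {f}))).presheaf.stalk v))
    (hg : IsBlowup g ((affineBlowup.idealSheaf (Ideal.span (Set.range (fun j : Fin 5 => Ideal.Quotient.mk (Ideal.span {f}) (X j))))).comap ((Spec (.of (MvPolynomial (Fin 5) k ⧸ Ideal.span {f}))).fromSpecStalk v))) :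
    (((affineBlowup.idealSheaf (Ideal.span (Set.range fun j : Fin 5 => Ideal.Quotient.mk (Ideal.span {f}) (X j)))).comap
        ((Spec (.of (MvPolynomial (Fin 5) k ⧸ Ideal.span {f}))).fromSpecStalk v)) ≠ ⊥ ∧
      ((((affineBlowup.idealSheaf (Ideal.span (Set.range fun j : Fin 5 => Ideal.Quotient.mk (Ideal.span {f}) (X j)))).comap
        ((Spec (.of (MvPolynomial (Fin 5) k ⧸ Ideal.span {f}))).fromSpecStalk v)).support :
          Set (Spec ((Spec (.of (MvPolynomial (Fin 5) k ⧸ Ideal.span {f}))).presheaf.stalk v))) ⊆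
        (Scheme.regularLocus (Spec ((Spec (.of (MvPolynomial (Fin 5) k ⧸ Ideal.span {f}))).presheaf.stalk v)))ᶜ) ∧
      (∀ s : S', g.base s ≠ closedPoint _ → s ∈ Scheme.regularLocus S') ∧ (∀ s : S', CMCl (S'.presheaf.stalk s))) ∧
    (∃ s : S', g.base s = closedPoint _ ∧ ¬ FullCl p (S'.presheaf.stalk s)) ∧
    (∃ 𝓚 : S'.IdealSheafData, 𝓚 ≠ ⊥ ∧ (∀ s ∈ (𝓚.support : Set S'), g.base s = closedPoint _) ∧
      ∀ (S'' : Scheme.{0}) (π : S'' ⟶ S'), IsBlowup π 𝓚 → ∀ s : S'', FullCl p (S''.presheaf.stalk s)) := by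
  -- the primality witness: `ω^{a₁} = −1` in `k = k̄`
  obtain ⟨ω, hω'⟩ := IsAlgClosed.exists_pow_nat_eq (-1 : k) (n := a₁) (by omega)
  have hω : ω ^ a₁ + 1 = 0 := by rw [hω']; ring
  have hprime := BrieskornPhamSpecimen.prime_f k c a₀ a₁ a₂ a₃ hc h₂ h₃ ha₀ ω hω f hf
  exact F108ClassRow.pointFloorRow_of_F108Consumable k p hF (by norm_num) f hprime
    (BrieskornPhamSpecimen.convenient_f k c a₀ a₁ a₂ a₃ hc h₀ h₁ h₂ h₃ f hf)
    (BrieskornPhamSpecimen.weaklyNondegenerate_f k c a₀ a₁ a₂ a₃ ha₀ ha₁ ha₂ ha₃ f hf)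
    (BrieskornPhamSpecimen.mk_X_ne_zero k c a₀ a₁ a₂ a₃ hc h₀ h₁ h₂ h₃ ha₀ ω hω f hf)
    (fun x hx => BrieskornPhamSpecimen.regular_off_vertex k c a₀ a₁ a₂ a₃ hc h₀ h₁ h₂ h₃ ha₀ ha₁ ha₂ ha₃ f hf x.asIdeal hx)
    (fun _ : Fin 5 => c) _ (BrieskornPhamRowOfF108.theta k c a₀ a₁ a₂ a₃ h₀ h₁ h₂ h₃ f hf)
    (BrieskornPhamSpecimen.f_not_mem_span_X k c a₀ a₁ a₂ a₃ hc h₀ h₁ h₂ h₃ f hf) (BrieskornPhamRowOfF108.g_not_mem_span_X k c a₀ a₁ a₂ a₃ h₀ h₁ h₂ h₃)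
    (BrieskornPhamSpecimen.constantCoeff_f k c a₀ a₁ a₂ a₃ hc h₀ h₁ h₂ h₃ f hf) 0 (BrieskornPhamRowOfF108.constantCoeff_g_zero k c a₀ a₁ a₂ a₃ hc h₀ h₁ h₂ h₃)
    (by
      rw [Matrix.cons_val_zero, g_zero_eq_listSum k c a₀ a₁ a₂ a₃]
      refine listSum_pow_mem_frobeniusPower k p _ ?_ (p - 1) ?_
      · simp only [List.mem_cons, List.not_mem_nil, or_false]; rintro t (rfl | rfl | rfl | rfl | rfl) <;> simp only <;> omega
      · simp only [List.map_cons, List.map_nil, List.sum_cons, List.sum_nil]; omega)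
    v hv (BrieskornPhamSpecimen.vertex_not_mem_regularLocus k c a₀ a₁ a₂ a₃ hc h₀ h₁ h₂ h₃ ha₀ ω hω f hf v hv) S' g hg

/-! ## §5 ★ BED W as a conditional member -/

/-- BED W written `t`-first: `rename (swap 0 3) (z³ + x⁴ + y⁵ + u⁵ + t⁷) = z³ + x⁷ + y⁵ + u⁵ + t⁴`. [plumbing] -/
theorem rename_swap_bedW (f : MvPolynomial (Fin 5) k) (hf : f = X 4 ^ 3 + X 0 ^ 4 + X 1 ^ 5 + X 2 ^ 5 + X 3 ^ 7) :
    rename (Equiv.swap (0 : Fin 5) 3) f = X 4 ^ 3 + X 0 ^ 7 + X 1 ^ 5 + X 2 ^ 5 + X 3 ^ 4 := by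
  subst hf
  simp only [map_add, map_pow, rename_X, Equiv.swap_apply_left, Equiv.swap_apply_right,
    Equiv.swap_apply_of_ne_of_ne (show (4 : Fin 5) ≠ 0 by decide) (show (4 : Fin 5) ≠ 3 by decide),
    Equiv.swap_apply_of_ne_of_ne (show (1 : Fin 5) ≠ 0 by decide) (show (1 : Fin 5) ≠ 3 by decide),
    Equiv.swap_apply_of_ne_of_ne (show (2 : Fin 5) ≠ 0 by decide) (show (2 : Fin 5) ≠ 3 by decide)]
  ring

/-- ★ **BED W `z³ + x⁴ + y⁵ + u⁵ + t⁷` (`p = 3`, `k = k̄`) IS A CONDITIONAL MEMBER OF THE BRIESKORN–PHAM CLASS ROW**: CONDITIONAL on `F108ClassRow.F108Consumable k 5`, every blowing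
up of `Spec 𝒪_{X,v}` along the point floor is LEGAL ∧ NOT FULL ∧ CURED — §4 for the exponent vector `(7, 5, 5, 4)` (five floors `⌊2/3⌋ + ⌊2/4⌋ + ⌊2/5⌋ + ⌊2/5⌋ + ⌊2/4⌋ =
0 < 2`: the `t`-chart origin is not F-pure, while the `x`-chart origin `z³ + x·unit` is regular) transported along the renaming `x ↔ t` (§3). The UNCONDITIONAL row of record is
✓ `P3d4z4557PointFloorRow.f4pos_row_p3_one` (by cells); this is the class routeʼs cross-certificate. [OURS · conditional; cite: IshiiSingularities2018, Thm. 4.4.23; Fedder1983,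
Thm. 1.12] -/
theorem bedW_row_of_F108Consumable [IsAlgClosed k] [CharP k 3] (hF : F108ClassRow.F108Consumable k 5)
    (f : MvPolynomial (Fin 5) k) (hf : f = X 4 ^ 3 + X 0 ^ 4 + X 1 ^ 5 + X 2 ^ 5 + X 3 ^ 7)
    (v : Spec (.of (MvPolynomial (Fin 5) k ⧸ Ideal.span {f})))
    (hv : v.asIdeal = Ideal.span (Set.range (fun j : Fin 5 => Ideal.Quotient.mk (Ideal.span {f}) (X j))))
    (S' : Scheme.{0}) (g : S' ⟶ Spec ((Spec (.of (MvPolynomial (Fin 5) k ⧸ Ideal.span {f}))).presheaf.stalk v))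
    (hg : IsBlowup g ((affineBlowup.idealSheaf (Ideal.span (Set.range (fun j : Fin 5 => Ideal.Quotient.mk (Ideal.span {f}) (X j))))).comap ((Spec (.of (MvPolynomial (Fin 5) k ⧸ Ideal.span {f}))).fromSpecStalk v))) :
    (((affineBlowup.idealSheaf (Ideal.span (Set.range fun j : Fin 5 => Ideal.Quotient.mk (Ideal.span {f}) (X j)))).comap
        ((Spec (.of (MvPolynomial (Fin 5) k ⧸ Ideal.span {f}))).fromSpecStalk v)) ≠ ⊥ ∧
      ((((affineBlowup.idealSheaf (Ideal.span (Set.range fun j : Fin 5 => Ideal.Quotient.mk (Ideal.span {f}) (X j)))).comap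
        ((Spec (.of (MvPolynomial (Fin 5) k ⧸ Ideal.span {f}))).fromSpecStalk v)).support :
          Set (Spec ((Spec (.of (MvPolynomial (Fin 5) k ⧸ Ideal.span {f}))).presheaf.stalk v))) ⊆
        (Scheme.regularLocus (Spec ((Spec (.of (MvPolynomial (Fin 5) k ⧸ Ideal.span {f}))).presheaf.stalk v)))ᶜ) ∧
      (∀ s : S', g.base s ≠ closedPoint _ → s ∈ Scheme.regularLocus S') ∧ (∀ s : S', CMCl (S'.presheaf.stalk s))) ∧
    (∃ s : S', g.base s = closedPoint _ ∧ ¬ FullCl 3 (S'.presheaf.stalk s)) ∧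
    (∃ 𝓚 : S'.IdealSheafData, 𝓚 ≠ ⊥ ∧ (∀ s ∈ (𝓚.support : Set S'), g.base s = closedPoint _) ∧
      ∀ (S'' : Scheme.{0}) (π : S'' ⟶ S'), IsBlowup π 𝓚 → ∀ s : S'', FullCl 3 (S''.presheaf.stalk s)) := by
  haveI : Fact (Nat.Prime 3) := ⟨Nat.prime_three⟩
  have hne : ∀ q : ℕ, ¬ 3 ∣ q → ((q : ℕ) : k) ≠ 0 := fun q hq h => hq ((CharP.cast_eq_zero_iff k 3 q).mp h)
  have h7 : ((7 : ℕ) : k) ≠ 0 := hne 7 (by norm_num)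
  have h5 : ((5 : ℕ) : k) ≠ 0 := hne 5 (by norm_num)
  have h4 : ((4 : ℕ) : k) ≠ 0 := hne 4 (by norm_num)
  exact pointFloorRow_of_rename k 3 (Equiv.swap (0 : Fin 5) 3) f _ (rename_swap_bedW k f hf)
    (fun v₁ hv₁ S₁ g₁ hg₁ => brieskornPhamRow_of_F108Consumable_of_fiveFloor k 3 hF 3 7 5 5 4 (by norm_num) (by norm_num) (by norm_num) (by norm_num) (by norm_num)
      h7 h5 h5 h4 (by norm_num) _ rfl v₁ hv₁ S₁ g₁ hg₁) v hv S' g hg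

end Summit.ResolutionOfSingularities.ResolutionOfSingularities.Theorems.FInjectiveMacaulayfication.BrieskornPhamMultiChart

end
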